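/-
Copyright: pub-hodgecm formalisation cell (harness21, 2026). New file (not vendored).
Origin: HOME/pub-hodgecm-landherr/LandherrClassification.lean (unit pub-hodgecm-landherr,
session planner-pub-hodgecm-landherr-0), expansion part (c); handover v1 2026-08-18T03:03:08Z (md5 102e9383), landed VERBATIM by the
gen-5 packager as `HodgeCM/Proofs/LandherrClassification.lean` (run 14).
-/
import Summits.HodgeConjecture.HodgeCM.StubTree.Inputs
import Summits.HodgeConjecture.HodgeCM.Proofs.Landherr
import Mathlib.FieldTheory.IsAlgClosed.Basic
import Mathlib.Analysis.Complex.Polynomial.Basic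

/-!
# Lemma 3.3(b), Landherr half — `HodgeCM.Lemma33bLandherr` from the Hasse–Minkowski theorem

`HodgeCM.Lemma33bLandherr` (`HodgeCM.StubTree.Inputs`) is the rank-2 case of Landherr's theorem
(W. Landherr, *Äquivalenz Hermitescher Formen über einem beliebigen algebraischen Zahlkörper*,
Abh. Math. Sem. Hamburg **11** (1936) 245–248; Deligne, LNM 900, "Hodge cycles on abelian varieties",
Prop. 4.1 p. 44; Cattani et al., *Hodge Theory*, Math. Notes 49, Thm 11.5.13 p. 506) exactly as PerL v5
uses it (`inputs/2001/…pmqp-galois-closure-y1__paper-v5-d912a121.tex` l. 299: "hermitian spaces over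
`L/L₀` are classified by dimension, determinant in `L₀^×/N(L^×)` and signatures", applied to the planes
`W₁ ⊕ W₂`, `W₃ ⊕ W₄`): two non-degenerate diagonal hermitian planes `⟨a₀, a₁⟩`, `⟨a₂, a₃⟩` over the CM
field `L` with the same signs at every complex embedding and `a₀a₁ ≡ a₂a₃ mod N(L^×)` are isometric.

Mathlib v4.32.0 has no local–global principle for quadratic (or hermitian) forms, no Hilbert symbol and
no local theory of quadratic forms, so the theorem is NOT provable inside the package today.  This file
isolates the single piece of number theory that is used, as ONE named textbook statement

* `HodgeCM.HasseMinkowskiQuinary` — O'Meara, *Introduction to Quadratic Forms* (Springer Grundlehren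
  117, 1963), Thm 66:1 (pp. 186–188: a regular quadratic space over a global field is isotropic iff it
  is isotropic at every spot) combined with 63:19 (p. 170: every quadratic space of dimension `≥ 5` over
  a (non-archimedean) local field is isotropic) and §61A (pp. 154–155: over a real complete field
  `ind V = min (ind⁺ V, ind⁻ V)`, so a regular space is isotropic iff it is indefinite); complex spots
  impose no condition (§61B).  Net statement: a diagonal form
  `∑ cᵢ xᵢ²` in `n ≥ 5` variables with all `cᵢ ≠ 0` over a number field `F`, indefinite at every real
  embedding of `F`, has a non-trivial zero in `F`.  (Equivalently Hasse–Minkowski 66:4 in dimension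
  `≥ 5`; this phrasing needs no completions.)

and PROVES `HodgeCM.lemma33bLandherr_of_hasseMinkowski : HasseMinkowskiQuinary → Lemma33bLandherr`
(an honest one-piece split in the sense of `CONTRIBUTING.md` L2/L4: the single piece is a published
theorem about quadratic forms over arbitrary number fields, not a restatement of the target; it carries
all the number-theoretic difficulty, the rest is `σ`-linear algebra proved here).

## Proof (Jacobson's reduction of hermitian to quadratic forms, O'Meara p. 186 footnote; Scharlau Ch. 10)
Write `σ` for complex conjugation of `L`, `L⁺ = L^σ` (Mathlib `NumberField.maximalRealSubfield`), pick
`θ ≠ 0` with `σθ = -θ` (`exists_skew`), so `L = L⁺ ⊕ L⁺θ`, `d := θ² ∈ L⁺` is negative at every real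
embedding of `L⁺`, and `N(u + vθ) = u² - d v²` for `u, v ∈ L⁺`.
1. (`exists_rep_of_hasseMinkowski`) The quinary form `a₀(X₀² - dX₁²) + a₁(X₂² - dX₃²) - a₂X₄²` over
   `L⁺` has non-zero coefficients and is indefinite at every real embedding `ρ` of `L⁺`: extend `ρ` to
   `τ : L → ℂ` (`IsAlgClosed.lift`), so `ρ(aᵢ) = Re τ(aᵢ)`, and the signature hypothesis at `τ` says the
   sign of `a₂` occurs among the signs of `a₀, a₁`.  A non-trivial zero gives `p, q ∈ L` with
   `a₀ N(p) + a₁ N(q) = a₂` (if `X₄ = 0` the plane `⟨a₀, a₁⟩` is hyperbolic and represents everything: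
   `p = P(1+m)`, `q = Q(1-m)`, `m = a₂ / (4a₀N(P))`).
2. (`isometry_of_rep`) With `a₀a₁ = a₂a₃ N(z)` and `w := (a₂ z)⁻¹`, the matrix
   `g = [[p, a₁ σ(q) w], [q, -a₀ σ(p) w]]` has `det g = -a₂ w ≠ 0` and `ᵗ(σg) · diag(a₀,a₁) · g =
   diag(a₂, a₀a₁a₂ N(w)) = diag(a₂, a₃)` — pure algebra.
-/

noncomputable section

open NumberField
open scoped Matrix

namespace HodgeCM

open Literature.AlgebraicGeometry.ShimuraVarieties (conjRingHomK embedding_conjRingHomK)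

/-- **Hasse–Minkowski theorem, quinary isotropy form** (O'Meara, *Introduction to Quadratic Forms*,
Grundlehren 117, Springer 1963: Thm 66:1 pp. 186–188 with 63:19 p. 170 and §61A pp. 154–155;
equivalently the Hasse–Minkowski theorem 66:4 p. 189 in dimension `≥ 5`; originally Hasse, J. reine
angew. Math. 153 (1924)).  A diagonal quadratic
form `∑ᵢ cᵢ xᵢ²` in `n ≥ 5` variables with non-zero coefficients over a number field `F` which is
indefinite at every real embedding `ρ : F →+* ℝ` (some `ρ(cᵢ) < 0` and some `ρ(cⱼ) > 0`) has a
non-trivial zero over `F`.  (Local solubility is automatic: at complex places trivially, at real places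
by indefiniteness, at finite places because `n ≥ 5`.)  Stated as a named `Prop` hypothesis; NOT provable
from Mathlib v4.32.0 (no completions-to-global principle, no Hilbert symbol).  It is the only piece of
number theory in Landherr's classification used by PerL Lemma 3.3(b). -/
def HasseMinkowskiQuinary : Prop :=
  ∀ (F : Type) [Field F] [NumberField F] (n : ℕ), 5 ≤ n → ∀ c : Fin n → F, (∀ i, c i ≠ 0) →
    (∀ ρ : F →+* ℝ, ∃ i j, ρ (c i) < 0 ∧ 0 < ρ (c j)) →
    ∃ x : Fin n → F, x ≠ 0 ∧ ∑ i, c i * x i ^ 2 = 0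

namespace Lemma33bLandherrProof

variable (L : CMField)

/-- A CM field has a non-zero purely imaginary element: `θ ≠ 0`, `σθ = -θ`. -/
theorem exists_skew : ∃ θ : L, θ ≠ 0 ∧ conjRingHomK L θ = -θ := by
  obtain ⟨x, hx⟩ : ∃ x : L, IsCMField.complexConj L x ≠ x := by
    by_contra! h
    exact IsCMField.complexConj_ne_one L (AlgEquiv.ext fun y => by simpa using h y)
  refine ⟨x - conjRingHomK L x, sub_ne_zero.mpr (fun h => hx h.symm), ?_⟩
  rw [map_sub, conjRingHomK_conjRingHomK]
  ring

/-- `σ`-fixed elements lie in the maximal real subfield `L⁺`. -/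
theorem mem_maximalRealSubfield {x : L} (hx : conjRingHomK L x = x) :
    x ∈ maximalRealSubfield L :=
  (IsCMField.complexConj_eq_self_iff L x).mp hx

/-- Elements of `L⁺` are `σ`-fixed. -/
theorem conj_coe_maximalRealSubfield (y : maximalRealSubfield L) :
    conjRingHomK L y = y :=
  (IsCMField.complexConj_eq_self_iff L (y : L)).mpr y.2

/-- `1, θ` are `L⁺`-linearly independent: `u + vθ = 0` with `u, v` fixed forces `u = v = 0`. -/
theorem eq_zero_of_add_mul_skew {θ u v : L} (hθ0 : θ ≠ 0) (hθ : conjRingHomK L θ = -θ)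
    (hu : conjRingHomK L u = u) (hv : conjRingHomK L v = v) (h : u + v * θ = 0) :
    u = 0 ∧ v = 0 := by
  have h' : u - v * θ = 0 := by
    have h2 := congrArg (conjRingHomK L) h
    rw [map_add, map_mul, hu, hv, hθ, map_zero] at h2
    linear_combination h2
  have hu0 : u = 0 := by
    have h3 : (2 : L) * u = 0 := by linear_combination h + h'
    exact (mul_eq_zero.mp h3).resolve_left two_ne_zero
  refine ⟨hu0, ?_⟩
  have h4 : v * θ = 0 := by linear_combination h - hu0
  exact (mul_eq_zero.mp h4).resolve_right hθ0

/-- Every real embedding of `L⁺` is the restriction of a complex embedding of `L`. -/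
theorem exists_embedding_extending (ρ : maximalRealSubfield L →+* ℝ) :
    ∃ τ : L →+* ℂ, ∀ y : maximalRealSubfield L, τ y = ((ρ y : ℝ) : ℂ) := by
  letI : Algebra (maximalRealSubfield L) ℂ := ((algebraMap ℝ ℂ).comp ρ).toAlgebra
  haveI : Algebra.IsAlgebraic (maximalRealSubfield L) L :=
    Algebra.IsAlgebraic.tower_top (K := ℚ) (maximalRealSubfield L)
  haveI : Module.IsTorsionFree (maximalRealSubfield L) ℂ := DivisionSemiring.to_moduleIsTorsionFree
  haveI : Module.IsTorsionFree (maximalRealSubfield L) L := DivisionSemiring.to_moduleIsTorsionFree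
  let τ : L →ₐ[maximalRealSubfield L] ℂ := IsAlgClosed.lift
  exact ⟨τ.toRingHom, fun y => τ.commutes y⟩

/-- **Step 1.** From the quinary Hasse–Minkowski statement: if the sign of `a₂` occurs among the signs of
`a₀, a₁` at every complex embedding (this is what the multiset-of-signs hypothesis of `Lemma33bLandherr`
gives), the hermitian plane `⟨a₀, a₁⟩` represents `a₂`: `a₀ N(p) + a₁ N(q) = a₂`. -/
theorem exists_rep_of_hasseMinkowski (hHM : HasseMinkowskiQuinary) (a : Fin 4 → L)
    (ha : ∀ i, conjRingHomK L (a i) = a i) (ha0 : ∀ i, a i ≠ 0)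
    (hsig : ∀ τ : L →+* ℂ,
      ({decide (0 < (τ (a 0)).re), decide (0 < (τ (a 1)).re)} : Multiset Bool) =
        {decide (0 < (τ (a 2)).re), decide (0 < (τ (a 3)).re)}) :
    ∃ p q : L, a 0 * (p * conjRingHomK L p) + a 1 * (q * conjRingHomK L q) = a 2 := by
  obtain ⟨θ, hθ0, hθ⟩ := exists_skew L
  have hθ2 : conjRingHomK L (θ ^ 2) = θ ^ 2 := by rw [map_pow, hθ, neg_sq]
  -- the coefficients of the quinary form over `F = L⁺`
  have hfix : ∀ y : maximalRealSubfield L, conjRingHomK L y = y := conj_coe_maximalRealSubfield L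
  let A : Fin 4 → maximalRealSubfield L := fun i => ⟨a i, mem_maximalRealSubfield L (ha i)⟩
  let D : maximalRealSubfield L := ⟨θ ^ 2, mem_maximalRealSubfield L hθ2⟩
  let c : Fin 5 → maximalRealSubfield L := ![A 0, -(D * A 0), A 1, -(D * A 1), -(A 2)]
  have hA0 : ∀ i, A i ≠ 0 := fun i h => ha0 i (by simpa [A] using congrArg Subtype.val h)
  have hD0 : D ≠ 0 := fun h => pow_ne_zero 2 hθ0 (by simpa [D] using congrArg Subtype.val h)
  have hc0 : ∀ i, c i ≠ 0 := by
    intro i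
    fin_cases i <;> simp [c, hA0, hD0]
  -- indefinite at every real embedding of `L⁺`
  have hsgn : ∀ ρ : maximalRealSubfield L →+* ℝ, ∃ i j, ρ (c i) < 0 ∧ 0 < ρ (c j) := by
    intro ρ
    obtain ⟨τ, hτ⟩ := exists_embedding_extending L ρ
    have hre : ∀ i, (τ (a i)).re = ρ (A i) := fun i => by
      rw [show a i = ((A i : maximalRealSubfield L) : L) from rfl, hτ]; simp
    have hρA : ∀ i, ρ (A i) ≠ 0 := fun i => (map_ne_zero ρ).mpr (hA0 i)
    -- `d = θ²` is negative at `ρ`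
    have hDneg : ρ D < 0 := by
      have h1 : τ (conjRingHomK L θ) = starRingEnd ℂ (τ θ) := embedding_conjRingHomK L τ θ
      rw [hθ, map_neg] at h1
      have hre0 : (τ θ).re = 0 := by
        have h1' := congrArg Complex.re h1
        simp only [Complex.neg_re, Complex.conj_re] at h1'
        linarith
      obtain ⟨s, hs⟩ : ∃ s : ℝ, τ θ = (s : ℂ) * Complex.I :=
        ⟨(τ θ).im, by apply Complex.ext <;> simp [hre0]⟩
      have hs0 : s ≠ 0 := by
        rintro rfl
        exact hθ0 ((map_eq_zero τ).mp (by simpa using hs))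
      have h2 : ((ρ D : ℝ) : ℂ) = ((-(s ^ 2) : ℝ) : ℂ) := by
        rw [← hτ D]
        show τ (θ ^ 2) = _
        rw [map_pow, hs, mul_pow, Complex.I_sq]
        push_cast
        ring
      have h3 : ρ D = -(s ^ 2) := by exact_mod_cast h2
      rw [h3]
      exact neg_lt_zero.mpr (sq_pos_iff.mpr hs0)
    -- the sign of `a₂` occurs among the signs of `a₀, a₁` at `τ`
    have h2mem : decide (0 < (τ (a 2)).re) ∈
        ({decide (0 < (τ (a 0)).re), decide (0 < (τ (a 1)).re)} : Multiset Bool) := by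
      rw [hsig τ]; simp
    have hcases : (0 < ρ (A 2) ↔ 0 < ρ (A 0)) ∨ (0 < ρ (A 2) ↔ 0 < ρ (A 1)) := by
      simpa [hre] using h2mem
    have hc0' : ρ (c 0) = ρ (A 0) := by simp [c]
    have hc1' : ρ (c 1) = -(ρ D * ρ (A 0)) := by simp [c]
    have hc2' : ρ (c 2) = ρ (A 1) := by simp [c]
    have hc3' : ρ (c 3) = -(ρ D * ρ (A 1)) := by simp [c]
    have hc4' : ρ (c 4) = -ρ (A 2) := by simp [c]
    rcases hcases with h | h
    · by_cases hp : 0 < ρ (A 0)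
      · exact ⟨4, 0, by rw [hc4']; linarith [h.mpr hp], by rw [hc0']; exact hp⟩
      · have hn0 : ρ (A 0) < 0 := lt_of_le_of_ne (not_lt.mp hp) (hρA 0)
        have hn2 : ρ (A 2) < 0 := lt_of_le_of_ne (not_lt.mp fun h2 => hp (h.mp h2)) (hρA 2)
        exact ⟨0, 4, by rw [hc0']; exact hn0, by rw [hc4']; linarith⟩
    · by_cases hp : 0 < ρ (A 1)
      · exact ⟨4, 2, by rw [hc4']; linarith [h.mpr hp], by rw [hc2']; exact hp⟩
      · have hn1 : ρ (A 1) < 0 := lt_of_le_of_ne (not_lt.mp hp) (hρA 1)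
        have hn2 : ρ (A 2) < 0 := lt_of_le_of_ne (not_lt.mp fun h2 => hp (h.mp h2)) (hρA 2)
        exact ⟨2, 4, by rw [hc2']; exact hn1, by rw [hc4']; linarith⟩
  -- a non-trivial zero over `L⁺`
  obtain ⟨x, hx0, hx⟩ := hHM (maximalRealSubfield L) 5 le_rfl c hc0 hsgn
  have hXfix : ∀ i, conjRingHomK L (x i) = x i := fun i => hfix (x i)
  have e0 : ((c 0 : maximalRealSubfield L) : L) = a 0 := rfl
  have e1 : ((c 1 : maximalRealSubfield L) : L) = -(θ ^ 2 * a 0) := rfl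
  have e2 : ((c 2 : maximalRealSubfield L) : L) = a 1 := rfl
  have e3 : ((c 3 : maximalRealSubfield L) : L) = -(θ ^ 2 * a 1) := rfl
  have e4 : ((c 4 : maximalRealSubfield L) : L) = -(a 2) := rfl
  have hxL : a 0 * (x 0 : L) ^ 2 + -(θ ^ 2 * a 0) * (x 1 : L) ^ 2 + a 1 * (x 2 : L) ^ 2
      + -(θ ^ 2 * a 1) * (x 3 : L) ^ 2 + -(a 2) * (x 4 : L) ^ 2 = 0 := by
    rw [Fin.sum_univ_five] at hx
    have h := congrArg Subtype.val hx
    push_cast at h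
    rw [e0, e1, e2, e3, e4] at h
    exact h
  -- `P = X₀ + X₁θ`, `Q = X₂ + X₃θ`, `a₀ N(P) + a₁ N(Q) = a₂ X₄²`
  obtain ⟨P, hP⟩ : ∃ P : L, P = (x 0 : L) + (x 1 : L) * θ := ⟨_, rfl⟩
  obtain ⟨Q, hQ⟩ : ∃ Q : L, Q = (x 2 : L) + (x 3 : L) * θ := ⟨_, rfl⟩
  have hσP : conjRingHomK L P = (x 0 : L) - (x 1 : L) * θ := by
    rw [hP, map_add, map_mul, hXfix, hXfix, hθ]; ring
  have hσQ : conjRingHomK L Q = (x 2 : L) - (x 3 : L) * θ := by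
    rw [hQ, map_add, map_mul, hXfix, hXfix, hθ]; ring
  have key : a 0 * (P * conjRingHomK L P) + a 1 * (Q * conjRingHomK L Q) = a 2 * (x 4 : L) ^ 2 := by
    rw [hσP, hσQ, hP, hQ]
    linear_combination hxL
  by_cases hX4 : (x 4 : L) = 0
  · -- `⟨a₀, a₁⟩` is isotropic, hence universal
    have key0 : a 0 * (P * conjRingHomK L P) + a 1 * (Q * conjRingHomK L Q) = 0 := by
      rw [key, hX4]; ring
    have hP0 : P ≠ 0 := by
      intro hPz
      have h01 := eq_zero_of_add_mul_skew L hθ0 hθ (hXfix 0) (hXfix 1) (hP ▸ hPz)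
      have hQz : Q = 0 := by
        have h5 : a 1 * (Q * conjRingHomK L Q) = 0 := by
          rw [hPz, zero_mul, mul_zero, zero_add] at key0; exact key0
        rcases mul_eq_zero.mp h5 with h6 | h6
        · exact absurd h6 (ha0 1)
        rcases mul_eq_zero.mp h6 with h7 | h7
        · exact h7
        · exact (map_eq_zero (conjRingHomK L)).mp h7
      have h23 := eq_zero_of_add_mul_skew L hθ0 hθ (hXfix 2) (hXfix 3) (hQ ▸ hQz)
      apply hx0
      funext i
      fin_cases i
      · exact ZeroMemClass.coe_eq_zero.mp h01.1
      · exact ZeroMemClass.coe_eq_zero.mp h01.2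
      · exact ZeroMemClass.coe_eq_zero.mp h23.1
      · exact ZeroMemClass.coe_eq_zero.mp h23.2
      · exact ZeroMemClass.coe_eq_zero.mp hX4
    have hσP0 : conjRingHomK L P ≠ 0 := fun h => hP0 ((map_eq_zero (conjRingHomK L)).mp h)
    have h4 : (4 : L) ≠ 0 := by norm_num
    have hY : 4 * a 0 * (P * conjRingHomK L P) ≠ 0 :=
      mul_ne_zero (mul_ne_zero h4 (ha0 0)) (mul_ne_zero hP0 hσP0)
    obtain ⟨m, hm⟩ : ∃ m : L, m = a 2 * (4 * a 0 * (P * conjRingHomK L P))⁻¹ := ⟨_, rfl⟩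
    have hm' : m * (4 * a 0 * (P * conjRingHomK L P)) = a 2 := by
      rw [hm, mul_assoc, inv_mul_cancel₀ hY, mul_one]
    have hmfix : conjRingHomK L m = m := by
      rw [hm]
      simp only [map_mul, map_inv₀, map_ofNat, ha, conjRingHomK_conjRingHomK]
      ring
    refine ⟨P * (1 + m), Q * (1 - m), ?_⟩
    rw [map_mul, map_mul, map_add, map_sub, map_one, hmfix]
    linear_combination (1 - m) ^ 2 * key0 + hm'
  · -- divide by `X₄`
    obtain ⟨u, hu⟩ : ∃ u : L, u = ((x 4 : L))⁻¹ := ⟨_, rfl⟩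
    have hu1 : u * (x 4 : L) = 1 := by rw [hu]; exact inv_mul_cancel₀ hX4
    have hufix : conjRingHomK L u = u := by rw [hu, map_inv₀, hXfix]
    refine ⟨P * u, Q * u, ?_⟩
    rw [map_mul, map_mul, hufix]
    linear_combination u ^ 2 * key + a 2 * (u * (x 4 : L) + 1) * hu1

/-- **Step 2 (pure algebra).** If `⟨a₀, a₁⟩` represents `a₂` (`a₀ N(p) + a₁ N(q) = a₂`) and the
discriminants agree (`a₀a₁ = a₂a₃ N(z)`), then `g = [[p, a₁ σ(q) w], [q, -a₀ σ(p) w]]`, `w = (a₂z)⁻¹`,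
is an isometry `⟨a₀, a₁⟩ ≅ ⟨a₂, a₃⟩`: `ᵗ(σ g) · diag(a₀, a₁) · g = diag(a₂, a₃)`. -/
theorem isometry_of_rep (a : Fin 4 → L) (ha : ∀ i, conjRingHomK L (a i) = a i) (ha0 : ∀ i, a i ≠ 0)
    (z : L) (hz0 : z ≠ 0) (hz : a 0 * a 1 = a 2 * a 3 * (z * conjRingHomK L z)) (p q : L)
    (hrep : a 0 * (p * conjRingHomK L p) + a 1 * (q * conjRingHomK L q) = a 2) :
    ∃ g : GL (Fin 2) L,
      ((g : Matrix (Fin 2) (Fin 2) L).transpose.map (conjRingHomK L)) * Matrix.diagonal ![a 0, a 1] *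
        (g : Matrix (Fin 2) (Fin 2) L) = Matrix.diagonal ![a 2, a 3] := by
  obtain ⟨w, hw⟩ : ∃ w : L, w = (a 2 * z)⁻¹ := ⟨_, rfl⟩
  have hw1 : w * (a 2 * z) = 1 := by rw [hw]; exact inv_mul_cancel₀ (mul_ne_zero (ha0 2) hz0)
  have hw1' : conjRingHomK L w * (a 2 * conjRingHomK L z) = 1 := by
    have h := congrArg (conjRingHomK L) hw1
    rwa [map_mul, map_mul, ha, map_one] at h
  have hw0 : w ≠ 0 := fun h => by rw [h, zero_mul] at hw1; exact zero_ne_one hw1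
  let G : Matrix (Fin 2) (Fin 2) L :=
    !![p, a 1 * conjRingHomK L q * w; q, -(a 0 * conjRingHomK L p * w)]
  have hdet : G.det ≠ 0 := by
    have hd : G.det = -(w * a 2) := by
      rw [Matrix.det_fin_two_of]
      linear_combination (-w) * hrep
    rw [hd]
    exact neg_ne_zero.mpr (mul_ne_zero hw0 (ha0 2))
  refine ⟨Matrix.GeneralLinearGroup.mkOfDetNeZero G hdet, ?_⟩
  rw [Matrix.GeneralLinearGroup.val_mkOfDetNeZero]
  ext i j
  fin_cases i <;> fin_cases j <;>
    simp [G, Matrix.mul_apply, Fin.sum_univ_two, Matrix.diagonal, map_mul, map_neg, ha,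
      conjRingHomK_conjRingHomK]
  · linear_combination hrep
  · ring
  · ring
  · linear_combination (a 0 * a 1 * w * conjRingHomK L w) * hrep + (w * conjRingHomK L w * a 2) * hz
      + (a 3 * (conjRingHomK L w * (a 2 * conjRingHomK L z))) * hw1 + a 3 * hw1'

end Lemma33bLandherrProof

/-- **Lemma 3.3(b), Landherr classification half, from Hasse–Minkowski.**  The typed target
`HodgeCM.Lemma33bLandherr` (rank-2 diagonal hermitian planes over a CM field with equal signatures and
equal discriminant class are isometric; Landherr 1936, Deligne LNM 900 Prop. 4.1, Cattani et al.
Thm 11.5.13; PerL v5 proof of Lemma 3.3(b), tex l. 299) follows from the quinary isotropy form of the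
Hasse–Minkowski theorem over the maximal real subfield (`HasseMinkowskiQuinary`, O'Meara 66:1 + 63:19 +
61A).  The hermitian-to-quadratic reduction (Jacobson) and the explicit isometry are proved in
`Lemma33bLandherrProof`. -/
theorem lemma33bLandherr_of_hasseMinkowski (hHM : HasseMinkowskiQuinary) : Lemma33bLandherr := by
  intro L a ha ha0 hsig hdisc
  obtain ⟨z, hz0, hz⟩ := hdisc
  obtain ⟨p, q, hrep⟩ := Lemma33bLandherrProof.exists_rep_of_hasseMinkowski L hHM a ha ha0 hsig
  exact Lemma33bLandherrProof.isometry_of_rep L a ha ha0 z hz0 hz p q hrep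

end HodgeCM

end
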